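import Summits.ValiantsHypothesis.ValiantsHypothesis.Theses.GrenetZeon

/-!
# Route `GrenetZeon`, deciding crux `AlgDcQP` (stmt-ValiantsHypothesis-8060) — the typed decomposition
# `TransferToDc → AbelianizationQP → PolySizeQPAlgebra → AlgDcQP`

`AlgDcQP` (X: for every `c`, for all large `n`, the permanent `per_n` has no `(m, s)`-representation
over a commutative coefficient algebra with `m, s ≤ 2^((log₂ n + c)^c)`) is at least as strong as
the summit statement (its `s = 1` slice is the Extended Valiant Hypothesis in dc form).  The route's
thesis records the decomposition `X ⇐ TransferToDc ∧ AbelianizationQP ∧ PolySizeQPAlgebra`; this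
file proves that implication, so that the three pieces become the route's leaves and `AlgDcQP` is
derived (crux-strategist, BC2 redirect; `ledger route edit … --split AlgDcQP --glue-by`).

* `TransferToDc` (stmt-8069, support, a theorem of the model): an `(m, s)`-representation of `per_n`
  gives an ordinary affine determinantal representation of size `(s + 1)(m + 1)^3`
  (Mahajan–Vinay division-free determinant ABP over `R`, regular representation, `λ`-sink;
  Ikenmeyer–Landsberg 2017, Thm. 4.1).
* `AbelianizationQP` (stmt-8063, crux): `∃ c`, every size-`m` determinantal representation of
  `per_n` yields an `(n^c + c, 2^((log₂ m + c)^c))`-representation.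
* `PolySizeQPAlgebra` (stmt-8064, crux): for every `c`, for all large `n`, no
  `(m, s)`-representation with `m ≤ n^c + c`, `s ≤ 2^((log₂ n + c)^c)`.

Proof (bookkeeping over ℕ only): an `(m, s)`-representation with `m, s ≤ 2^Q`, `Q = (log₂ n + c)^c`,
transfers to `dc(per_n) ≤ M := (s+1)(m+1)^3 ≤ 2^(4Q+4)`; abelianization (constant `a`) turns that
into an `(n^a + a, 2^((log₂ M + a)^a))`-representation; and
`(log₂ M + a)^a ≤ (4Q + 4 + a)^a ≤ (log₂ n + C)^C` with `C = (c + a + 8)(a + 1)`, so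
`PolySizeQPAlgebra` at `C` forbids it for `n ≥ n₀(C)` (and `n ≥ 1`).  No definitions, no named
facts; Mathlib + tree only.
-/

noncomputable section

-- `Summit.ValiantsHypothesis.ValiantsHypothesis.…` is the tree's mandated single-conjunct layout.
set_option linter.dupNamespace false

namespace Summit.ValiantsHypothesis.ValiantsHypothesis.Theorems.GrenetZeon.AlgDcQPSplit

open Literature.Computability.AlgebraicComplexity
open Summit.ValiantsHypothesis.ValiantsHypothesis.Theses.GrenetZeon

/-! ### ℕ bookkeeping: quasi-polynomial of quasi-polynomial is quasi-polynomial -/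

/-- `(L + c)^c ≥ 1` (for `c = 0` it is `1`, otherwise the base is positive). -/
theorem one_le_pow_add (L c : ℕ) : 1 ≤ (L + c) ^ c := by
  rcases Nat.eq_zero_or_pos c with rfl | hc
  · simp
  · exact Nat.one_le_pow _ _ (by omega)

/-- First absorption step: `4 (L+c)^c + 4 + a ≤ (L + c + a + 8)^(c+1)`. -/
theorem step_base (L c a : ℕ) : 4 * (L + c) ^ c + 4 + a ≤ (L + c + a + 8) ^ (c + 1) := by
  have h1 : 1 ≤ (L + c) ^ c := one_le_pow_add L c
  have h2 : (L + c) ^ c ≤ (L + c + a + 8) ^ c := Nat.pow_le_pow_left (by omega) c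
  have h3 : 4 + a ≤ (L + c + a + 4) * (L + c) ^ c :=
    calc 4 + a = (a + 4) * 1 := by ring
      _ ≤ (a + 4) * (L + c) ^ c := Nat.mul_le_mul_left _ h1
      _ ≤ (L + c + a + 4) * (L + c) ^ c := Nat.mul_le_mul_right _ (by omega)
  calc 4 * (L + c) ^ c + 4 + a
      = 4 * (L + c) ^ c + (4 + a) := by ring
    _ ≤ 4 * (L + c) ^ c + (L + c + a + 4) * (L + c) ^ c := Nat.add_le_add_left h3 _
    _ = (L + c + a + 8) * (L + c) ^ c := by ring
    _ ≤ (L + c + a + 8) * (L + c + a + 8) ^ c := Nat.mul_le_mul_left _ h2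
    _ = (L + c + a + 8) ^ (c + 1) := by ring

/-- Second absorption step: `(4 (L+c)^c + 4 + a)^a ≤ (L + C)^C` with `C = (c + a + 8)(a + 1)`. -/
theorem step_pow (L c a : ℕ) :
    (4 * (L + c) ^ c + 4 + a) ^ a ≤ (L + (c + a + 8) * (a + 1)) ^ ((c + a + 8) * (a + 1)) := by
  have hC1 : c + a + 8 ≤ (c + a + 8) * (a + 1) := Nat.le_mul_of_pos_right _ (by omega)
  have hC2 : (c + 1) * a ≤ (c + a + 8) * (a + 1) := Nat.mul_le_mul (by omega) (by omega)
  calc (4 * (L + c) ^ c + 4 + a) ^ a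
      ≤ ((L + c + a + 8) ^ (c + 1)) ^ a := Nat.pow_le_pow_left (step_base L c a) a
    _ = (L + c + a + 8) ^ ((c + 1) * a) := by rw [← pow_mul]
    _ ≤ (L + (c + a + 8) * (a + 1)) ^ ((c + 1) * a) := Nat.pow_le_pow_left (by omega) _
    _ ≤ (L + (c + a + 8) * (a + 1)) ^ ((c + a + 8) * (a + 1)) :=
        Nat.pow_le_pow_right (by omega) hC2

/-- The transfer size `M = (s+1)(m+1)^3` of a representation inside the box `m, s ≤ 2^((L+c)^c)`
has `log₂ M ≤ 4 (L+c)^c + 4`. -/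
theorem log_transfer_le (L c m s : ℕ) (hm : m ≤ 2 ^ ((L + c) ^ c)) (hs : s ≤ 2 ^ ((L + c) ^ c)) :
    Nat.log 2 ((s + 1) * (m + 1) ^ 3) ≤ 4 * (L + c) ^ c + 4 := by
  set Q := (L + c) ^ c with hQ
  have hQ1 : 1 ≤ 2 ^ Q := Nat.one_le_two_pow
  have hm' : m + 1 ≤ 2 ^ (Q + 1) := by rw [pow_succ]; omega
  have hs' : s + 1 ≤ 2 ^ (Q + 1) := by rw [pow_succ]; omega
  have h1 : (s + 1) * (m + 1) ^ 3 ≤ 2 ^ (4 * Q + 4) :=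
    calc (s + 1) * (m + 1) ^ 3 ≤ 2 ^ (Q + 1) * (2 ^ (Q + 1)) ^ 3 :=
          Nat.mul_le_mul hs' (Nat.pow_le_pow_left hm' 3)
      _ = 2 ^ (4 * Q + 4) := by ring
  calc Nat.log 2 ((s + 1) * (m + 1) ^ 3) ≤ Nat.log 2 (2 ^ (4 * Q + 4)) := Nat.log_mono_right h1
    _ = 4 * Q + 4 := Nat.log_pow (by norm_num) _

/-! ### The decomposition -/

/-- **`AlgDcQP` from its three pieces** (route `GrenetZeon`, BC2 redirect of the deciding crux):
`TransferToDc → AbelianizationQP → PolySizeQPAlgebra → AlgDcQP`.  Given `c`, let `a` be the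
abelianization constant and `C := (c + a + 8)(a + 1)`; take `n₀` from `PolySizeQPAlgebra` at `C`
(and `n ≥ 1`).  An `(m, s)`-representation with `m, s ≤ 2^((log₂ n + c)^c)` transfers to an affine
determinantal representation of size `M = (s+1)(m+1)^3`, abelianizes to an
`(n^a + a, 2^((log₂ M + a)^a))`-representation, and `n^a + a ≤ n^C + C`,
`(log₂ M + a)^a ≤ (log₂ n + C)^C` put it inside the box that `PolySizeQPAlgebra` excludes. -/
theorem AlgDcQP_of_subs (hT : TransferToDc) (hA : AbelianizationQP) (hP : PolySizeQPAlgebra) :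
    AlgDcQP := by
  obtain ⟨a, ha⟩ := hA
  intro c
  obtain ⟨n₀, hn₀⟩ := hP ((c + a + 8) * (a + 1))
  refine ⟨max n₀ 1, fun n hn m s hm hs hrep => ?_⟩
  have hn₀n : n₀ ≤ n := le_of_max_le_left hn
  have h1n : 1 ≤ n := le_of_max_le_right hn
  have hCa : a ≤ (c + a + 8) * (a + 1) :=
    calc a ≤ (c + a + 8) * 1 := by omega
      _ ≤ (c + a + 8) * (a + 1) := Nat.mul_le_mul_left _ (by omega)
  -- transfer to ordinary determinantal complexity
  have hdc : HasDetRepr (perPoly (Fin n) ℂ) ((s + 1) * (m + 1) ^ 3) := hT n m s hrep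
  -- abelianize at quasi-polynomial cost
  have hrep' := ha n ((s + 1) * (m + 1) ^ 3) h1n hdc
  -- the polynomial-size exclusion at constant `C` forbids the result
  refine hn₀ n hn₀n (n ^ a + a) (2 ^ ((Nat.log 2 ((s + 1) * (m + 1) ^ 3) + a) ^ a)) ?_ ?_ hrep'
  · exact Nat.add_le_add (Nat.pow_le_pow_right h1n hCa) hCa
  · exact Nat.pow_le_pow_right (by norm_num)
      ((Nat.pow_le_pow_left (Nat.add_le_add_right (log_transfer_le _ c m s hm hs) a) a).trans
        (step_pow _ c a))

end Summit.ValiantsHypothesis.ValiantsHypothesis.Theorems.GrenetZeon.AlgDcQPSplit
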